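import Literature.Geometry.ComplexAnalytic.MarkedFamilyHomCriterion
import HarnessLib

/-!
# Gluing the marked-family hom criterion over a cover: fibrewise-linear holomorphic maps of analytic families of complex
# tori given chart by chart, and compatible on the fibres, glue to ONE holomorphic map of families
# ([BirkenhakeLange2004] §1.2 Prop. 1.2.1 in families; [Shimura1963AnalyticFamilies] §2)

Layer `Literature/Geometry/ComplexAnalytic`, namespace `Literature.Geometry.ComplexAnalytic.IsRelExpChartOn` (dot notation on the ★ U6
currency `IsRelExpChartOn`, `RelativeExponentialChart.lean`; sequel of ★ U6-b `MarkedFamilyHomCriterion.lean`).  THEOREMS ONLY (no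
definition, no named fact, no instance, no notation, no `sorry`).  Cell `hodgecm-mathlib` (D-0151), FLOOR 0, P6 «MOD» (crux hLiu418 =
stmt-HodgeConjecture-24832, `--supports`), organ **U6-b′ «GLUE»** of the E6 closer of `Cruxes/HLiu418/Lines/F0_P6a_PELWitnessE.lean`
(`stub_E6`, socket Σ-ℂ `ReadsC`; E6 heir A-p06 (g33)): the relative exponential charts of the universal family (★ P-3
`siegelUniversalFamilyUniformisation`) exist only LOCALLY on the analytified record curve (over the domains of holomorphic lifts through the
Siegel uniformisation), so the holomorphic endomorphism read chart by chart from the lattice reading `Mρ a b` (★ U6-b) has to be GLUED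
before GAGA (★ E6-an `AbelianSchemeOver.exists_isMonHom_of_mdifferentiable`) applies.  HC_CM is proved only modulo the printed citations
until rung 0 closes; this file is generic and changes no count.

THE MATHEMATICS.  Let `p : M → B`, `p′ : M′ → B` be two families, `U_i ⊆ B` opens with relative exponential charts `ex_i` of `p` and `ex′_i`
of `p′` over `U_i` (★ `IsRelExpChartOn`), the `U_i` covering `p(M)`, and `C_i b : E →L[ℂ] E′` holomorphic families over `U_i` carrying the
periods of `ex_i` to periods of `ex′_i`.  By ★ U6-b each chart gives a holomorphic `y_i` over `U_i` with `y_i (ex_i (b, z)) = ex′_i (b, C_i b z)`.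
If the recipes are COMPATIBLE ON THE FIBRES — `ex_i (b, z) = ex_j (b, z′) ⟹ ex′_i (b, C_i b z) = ex′_j (b, C_j b z′)` for `b ∈ U_i ∩ U_j` — then
`y_i = y_j` over `U_i ∩ U_j` (every point over `U_j` is an `ex_j (b, z′)`), so `y m := y_{i(m)} m` for any choice `p m ∈ U_{i(m)}` is
independent of the choice, satisfies every chart recipe, lies over `B`, and is holomorphic (it agrees with `y_j` on the open `p⁻¹ U_j`).
This is the families version of [BirkenhakeLange2004] §1.2 Prop. 1.2.1 run on an atlas ([Shimura1963AnalyticFamilies] §2: endomorphisms of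
an analytic family of abelian varieties from endomorphisms of the period lattice, sheet by sheet).

* §1 `comp_ex_eq_of_compatible` — a map satisfying the recipe of chart `j` satisfies the recipe of chart `i` over `U_i ∩ U_j`.
* §2 **`exists_mdifferentiable_of_cover`** — THE HEAD: one holomorphic `y : M → M′` over `B` with `y (ex_i (b, z)) = ex′_i (b, C_i b z)`
  for EVERY chart of the cover.

## References
* [BirkenhakeLange2004] C. Birkenhake, H. Lange, *Complex Abelian Varieties*, 2nd ed. (2004), §1.2 Proposition 1.2.1 (homomorphisms of complex
  tori = `ℂ`-linear maps respecting the lattices).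
* [Shimura1963AnalyticFamilies] G. Shimura, *On analytic families of polarized abelian varieties and automorphic functions*, Ann. Math. 78 (1963), §2.
-/

set_option autoImplicit false

noncomputable section

open scoped Manifold

namespace Literature.Geometry.ComplexAnalytic

namespace IsRelExpChartOn

variable {EB : Type*} [NormedAddCommGroup EB] [NormedSpace ℂ EB] {B : Type*} [TopologicalSpace B] [ChartedSpace EB B]
  {E : Type*} [NormedAddCommGroup E] [NormedSpace ℂ E] {ι : Type*}
  {EM : Type*} [NormedAddCommGroup EM] [NormedSpace ℂ EM] {M : Type*} [TopologicalSpace M] [ChartedSpace EM M]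
  {E' : Type*} [NormedAddCommGroup E'] [NormedSpace ℂ E'] {ι' : Type*}
  {EM' : Type*} [NormedAddCommGroup EM'] [NormedSpace ℂ EM'] {M' : Type*} [TopologicalSpace M'] [ChartedSpace EM' M']
  {p : M → B} {p' : M' → B} {I : Type*} {U : I → Set B}
  {Φ : I → B → ((ι → ℝ) ≃L[ℝ] E)} {Φ' : I → B → ((ι' → ℝ) ≃L[ℝ] E')}
  {ex : I → B × E → M} {ex' : I → B × E' → M'}

/-! ## §1 Compatibility transfers the chart recipe -/

omit [TopologicalSpace B] [ChartedSpace EB B] [NormedAddCommGroup E] [NormedSpace ℂ E] [TopologicalSpace M] [ChartedSpace EM M]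
  [NormedAddCommGroup E'] [NormedSpace ℂ E'] [TopologicalSpace M'] [ChartedSpace EM' M'] in
/-- **Compatible recipes agree**: if `y` satisfies the recipe of chart `j` over `U_j` (`y (ex_j (b, z′)) = ex′_j (b, C_j b z′)`), every point
over `U_j` is an `ex_j (b, z′)`, and the recipes of `i` and `j` are compatible on the fibres over `U_i ∩ U_j`, then `y` satisfies the recipe
of chart `i` at every `ex_i (b, z)` with `b ∈ U_i ∩ U_j`. [cite: BirkenhakeLange2004, §1.2 Proposition 1.2.1] -/
theorem comp_ex_eq_of_compatible {i j : I} (hj : ∀ m : M, p m ∈ U j → ∃ z' : E, ex j (p m, z') = m)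
    (hpi : ∀ b ∈ U i, ∀ z : E, p (ex i (b, z)) = b) {C : I → B → E → E'}
    (hcompat : ∀ b ∈ U i ∩ U j, ∀ (z z' : E), ex i (b, z) = ex j (b, z') → ex' i (b, C i b z) = ex' j (b, C j b z'))
    {y : M → M'} (hy : ∀ b ∈ U j, ∀ z' : E, y (ex j (b, z')) = ex' j (b, C j b z'))
    {b : B} (hb : b ∈ U i ∩ U j) (z : E) : y (ex i (b, z)) = ex' i (b, C i b z) := by
  have hpb : p (ex i (b, z)) = b := hpi b hb.1 z
  obtain ⟨z', hz'⟩ := hj (ex i (b, z)) (hpb.symm ▸ hb.2)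
  rw [hpb] at hz'
  rw [← hz', hy b hb.2 z', ← hcompat b hb z z' hz'.symm]

/-! ## §2 The head: gluing over a cover -/

/-- **GLUING THE MARKED-FAMILY HOM CRITERION OVER A COVER.**  Let `ex_i`, `ex′_i` be relative exponential charts of `p : M → B`,
`p′ : M′ → B` over opens `U_i` covering `p(M)` (`p` continuous), `C_i b : E →L[ℂ] E′` holomorphic on `U_i` carrying periods to periods
(`C_i b ∘ Φ_i b = Φ′_i b ∘ N_i b` on `ℤ^ι`), and assume the recipes are COMPATIBLE ON THE FIBRES over the overlaps:
`ex_i (b, z) = ex_j (b, z′) ⟹ ex′_i (b, C_i b z) = ex′_j (b, C_j b z′)`.  Then there is ONE map `y : M → M′`, HOLOMORPHIC on `M`, lying over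
`B`, with `y (ex_i (b, z)) = ex′_i (b, C_i b z)` for every `i`, `b ∈ U_i`, `z` (chartwise ★ U6-b `exists_mdifferentiableOn_comp_ex_eq`; the local
maps agree on overlaps by §1, so any choice of chart per point defines `y`, which is locally one of them).  In E6: `B = X_ℂ^an` the record
curve, the `U_i` the domains of holomorphic lifts through the Siegel uniformisation, `C_i b` the `ℂ`-linear avatar of the lattice reading.
[cite: BirkenhakeLange2004, §1.2 Proposition 1.2.1] [cite: Shimura1963AnalyticFamilies, §2] -/
theorem exists_mdifferentiable_of_cover (h : ∀ i, IsRelExpChartOn EB EM p (U i) (Φ i) (ex i))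
    (h' : ∀ i, IsRelExpChartOn EB EM' p' (U i) (Φ' i) (ex' i)) (hcov : ∀ m : M, ∃ i, p m ∈ U i) (hp : Continuous p)
    (C : I → B → (E →L[ℂ] E')) (hC : ∀ i, MDifferentiableOn 𝓘(ℂ, EB) 𝓘(ℂ, E →L[ℂ] E') (C i) (U i))
    (N : I → B → ((ι → ℤ) → (ι' → ℤ)))
    (hN : ∀ i, ∀ b ∈ U i, ∀ n : ι → ℤ, C i b (Φ i b (fun k => (n k : ℝ))) = Φ' i b (fun k => (N i b n k : ℝ)))
    (hcompat : ∀ i j, ∀ b ∈ U i ∩ U j, ∀ (z z' : E), ex i (b, z) = ex j (b, z') → ex' i (b, C i b z) = ex' j (b, C j b z')) :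
    ∃ y : M → M', (∀ i, ∀ b ∈ U i, ∀ z : E, y (ex i (b, z)) = ex' i (b, C i b z)) ∧ (∀ m : M, p' (y m) = p m) ∧
      MDifferentiable 𝓘(ℂ, EM) 𝓘(ℂ, EM') y := by
  classical
  -- the chartwise maps (★ U6-b)
  have hloc := fun i => (h i).exists_mdifferentiableOn_comp_ex_eq (h' i) (C i) (hC i) (N i) (hN i)
  choose y hy hpy hdy _huniq using hloc
  -- any two of them agree over the overlap
  have hagree : ∀ i j, ∀ b ∈ U i ∩ U j, ∀ z : E, y j (ex i (b, z)) = ex' i (b, C i b z) := fun i j b hb z =>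
    comp_ex_eq_of_compatible (C := fun i b z => C i b z) (fun m hm => (h j).ex_surj m hm) (h i).p_ex
      (fun b hb z z' hzz' => hcompat i j b hb z z' hzz') (hy j) hb z
  -- a chart per point
  choose idx hidx using hcov
  refine ⟨fun m => y (idx m) m, ?_, ?_, ?_⟩
  · intro i b hb z
    have hpb : p (ex i (b, z)) = b := (h i).p_ex b hb z
    have h2 : p (ex i (b, z)) ∈ U (idx (ex i (b, z))) := hidx _
    rw [hpb] at h2
    exact hagree i (idx (ex i (b, z))) b ⟨hb, h2⟩ z
  · intro m
    exact hpy (idx m) m (hidx m)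
  · intro m
    -- near `m`, the glued map IS `y (idx m)`: both satisfy the recipe of chart `idx m` over the open `p ⁻¹ (U (idx m))`
    set j := idx m with hj
    have hopen : IsOpen (p ⁻¹' U j) := (h j).isOpen.preimage hp
    have hloc : (fun m'' => y (idx m'') m'') =ᶠ[nhds m] y j := by
      filter_upwards [hopen.mem_nhds (show m ∈ p ⁻¹' U j from hidx m)] with m'' hm''
      obtain ⟨z, hz⟩ := (h j).ex_surj m'' hm''
      rw [← hz, hy j (p m'') hm'' z]
      have hpb : p (ex j (p m'', z)) = p m'' := (h j).p_ex _ hm'' z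
      have h2 : p (ex j (p m'', z)) ∈ U (idx (ex j (p m'', z))) := hidx _
      rw [hpb] at h2
      exact hagree j (idx (ex j (p m'', z))) (p m'') ⟨hm'', h2⟩ z
    refine MDifferentiableAt.congr_of_eventuallyEq ?_ hloc
    exact (hdy j m (hidx m)).mdifferentiableAt (hopen.mem_nhds (hidx m))

end IsRelExpChartOn

end Literature.Geometry.ComplexAnalytic

end
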